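import Literature.AlgebraicGeometry.Motives.FlatFamilyHilbertPolynomialGrassmannianPoint
import HarnessLib

/-!
# Base change of the determinant class `[det (p_Z)_* 𝒪_Z(d)]` of a flat embedded family at the regularity degree

Layer `Literature/AlgebraicGeometry/Motives`, namespace `Literature.AlgebraicGeometry.Motives` (sibling of ★ ③b
`FlatFamilyHilbertPolynomialGrassmannianPoint`).  THEOREMS ONLY (no definition, no named fact, no instance, no notation, no `sorry`).  Cell
`hodgecm-mathlib` (D-0151), floor-0 programme P1, sub-line F-13 `Lines/F13PluckerProducer`, last socket P4 `stub_PLofHilbertBase`, socket S5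
of the P4 census (`B-provers/B-p11/g20/F13P3/P4/SOCKETS-P4.v0`, F0P1d-plan PLAN v1 §2 FILE A §2): «`v^*[det p_*𝒪_{Z}(d)] = [det π_*𝒪_X(d)]`» for
a flat closed family `Z ⊂ 𝐏(ι; T)` with Hilbert polynomial `P` and every cartesian square over `v : T' → T`, at any degree `d` past Mumford's
regularity bound (the Plücker degree of the Hilbert scheme).  Count-neutral capital: HC_CM is proved only modulo the 7 printed citations until
rung 0 closes — nothing here bears on a summit statement.

[Mumford1966CurvesSurface] Lecture 15 (II.) / [Hartshorne1977] III Thm. 12.11, Cor. 12.9: for a flat family with `H¹(Z_t, 𝒪_{Z_t}(d)) = 0` on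
every fibre, `(p_Z)_*𝒪_Z(d)` is locally free and its formation commutes with base change; Mumford's regularity bound `d ≥ B(P) − 1` gives
the fibrewise vanishing (★ ③b `forall_fieldPoint_letters_of_hasRank_twists`, clause (1)), and ★ α
`isIso_pushforwardBaseChangeHom_twistMod_of_forall_fieldPoint` the base-change ISOMORPHISM; `[det]` is an isomorphism invariant commuting
with pull-back (★ `detClass_eq_of_iso`, ★ `detClass_pullback`), and `𝒪_Z(d)` pulls back to `𝒪_{Z'}(d)` along the square (★ `isIso_pullbackTwistHom`).

* `isIso_pushforwardBaseChangeHom_twistMod_of_hasRank_twists` — the base-change morphism is an isomorphism (③b letters ⇒ ★ α).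
* **`detClass_pushforward_pullback_twistMod_eq_pullback`** — `[det (p_{T'})_*(pr^*𝒪_Z(d))] = v^*[det (p_Z)_*𝒪_Z(d)]` (any witnesses).
* **`detClass_pushforward_twistMod_comp_eq_pullback`** — the same with `𝒪_{Z'}(d) := twistMod (pr ≫ i ≫ pr₂) 𝒪 d` on the base-changed
  family; `hasRank_pushforward_twistMod_comp` — its rank `k = P(d)`.

## References
* [Mumford1966CurvesSurface] D. Mumford, *Lectures on Curves on an Algebraic Surface* (1966), Lecture 15 (II.).
* [Hartshorne1977] R. Hartshorne, *Algebraic Geometry* (1977), III Thm. 12.11 (p. 290), Cor. 12.9; II Prop. 5.12 (c) (p. 117); II Ex. 6.8.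
-/

noncomputable section

-- `TopCat.Presheaf`/`Scheme.Modules` are not reducible (as in Mathlib's `AlgebraicGeometry/Modules/Sheaf.lean`).
set_option backward.isDefEq.respectTransparency false

open CategoryTheory CategoryTheory.Limits AlgebraicGeometry TopologicalSpace Opposite

namespace Literature.AlgebraicGeometry.Motives

open CategoryTheory.Abelian Polynomial
open Literature.AlgebraicGeometry.Modules Literature.AlgebraicGeometry.Morphisms Literature.AlgebraicGeometry.Morphisms.ProjCech
open Literature.Algebra.Homology.LaurentCech (regularityBound)

variable {ι : Type} (hn : 1 ≤ Nat.card ι) {T Z : Scheme.{0}} [IsLocallyNoetherian T]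
  (i : Z ⟶ Morphisms.projectiveSpace ι T) [IsClosedImmersion i] [Flat (i ≫ Morphisms.projectiveSpaceFst ι T)]
  (P : ℚ[X]) (e₀ : ℕ) (R : ℕ → ℕ) (hR : ∀ e, e₀ ≤ e → (R e : ℚ) = P.eval (e : ℚ))
  (hrk : ∀ e, e₀ ≤ e → HasRank ((Scheme.Modules.pushforward (i ≫ Morphisms.projectiveSpaceFst ι T)).obj
    (SerreTwist.twistMod (i ≫ pullback.snd (terminal.from T) (terminal.from (Morphisms.projectiveSpaceInt ι))) (unitModule Z) e)) (R e))
  (d k : ℕ) (hk : (k : ℚ) = P.eval (d : ℚ))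
  (hd : regularityBound (preHilbertPoly ℚ (Nat.card ι) 0) 0 (preHilbertPoly ℚ (Nat.card ι) 0 - P) - 1 ≤ (d : ℤ))
  {T' ZT' : Scheme.{0}} {pr : ZT' ⟶ Z} {pT' : ZT' ⟶ T'} {b : T' ⟶ T}
  (H : IsPullback pr pT' (i ≫ Morphisms.projectiveSpaceFst ι T) b)

include hn hR hrk hk hd in
/-- **The formation of `(p_Z)_*𝒪_Z(d)` commutes with every base change at a degree `d ≥ B(P) − 1`**: the base-change morphism of ★
`Modules/PushforwardBaseChangeHom` is an isomorphism — fibrewise `Ext¹(𝒪_{X₀}, 𝒪_Z(d)|_{X₀}) = 0` by ★ ③b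
`forall_fieldPoint_letters_of_hasRank_twists` (1), then ★ α `isIso_pushforwardBaseChangeHom_twistMod_of_forall_fieldPoint`.
[cite: Mumford1966CurvesSurface, Lecture 15 (II.)] [cite: Hartshorne1977, III Thm. 12.11 (p. 290), Cor. 12.9] -/
theorem isIso_pushforwardBaseChangeHom_twistMod_of_hasRank_twists :
    IsIso (pushforwardBaseChangeHom H.w
      (SerreTwist.twistMod (i ≫ pullback.snd (terminal.from T) (terminal.from (Morphisms.projectiveSpaceInt ι))) (unitModule Z) d)) :=
  isIso_pushforwardBaseChangeHom_twistMod_of_forall_fieldPoint i d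
    (fun _ _ _ kX f₀ x Hx => (forall_fieldPoint_letters_of_hasRank_twists hn i P e₀ R hR hrk d k hk hd kX f₀ x Hx).1) H

include hn hR hrk hk hd H in
/-- **`[det (p_{T'})_*(pr^* 𝒪_Z(d))] = v^*[det (p_Z)_* 𝒪_Z(d)]` in `Ȟ¹(T', 𝒪^×)`** for every cartesian square over `v : T' → T` (any
local-freeness witnesses): the base-change isomorphism and ★ `detClass_pullback`. [cite: Hartshorne1977, III Thm. 12.11 (p. 290), Cor. 12.9] [cite: Hartshorne1977, II Ex. 6.8] -/
theorem detClass_pushforward_pullback_twistMod_eq_pullback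
    (hP : IsFiniteLocallyFree ((Scheme.Modules.pushforward (i ≫ Morphisms.projectiveSpaceFst ι T)).obj
      (SerreTwist.twistMod (i ≫ pullback.snd (terminal.from T) (terminal.from (Morphisms.projectiveSpaceInt ι))) (unitModule Z) d)))
    (hP' : IsFiniteLocallyFree ((Scheme.Modules.pushforward pT').obj ((Scheme.Modules.pullback pr).obj
      (SerreTwist.twistMod (i ≫ pullback.snd (terminal.from T) (terminal.from (Morphisms.projectiveSpaceInt ι))) (unitModule Z) d)))) :
    detClass hP' = CechPic.pullback b (detClass hP) := by
  haveI := isIso_pushforwardBaseChangeHom_twistMod_of_hasRank_twists hn i P e₀ R hR hrk d k hk hd H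
  rw [← detClass_pullback b hP]
  exact (detClass_eq_of_iso (asIso (pushforwardBaseChangeHom H.w
    (SerreTwist.twistMod (i ≫ pullback.snd (terminal.from T) (terminal.from (Morphisms.projectiveSpaceInt ι))) (unitModule Z) d))) _ _).symm

include hn hR hrk hk hd H in
/-- **`[det (p_{T'})_* 𝒪_{Z'}(d)] = v^*[det (p_Z)_* 𝒪_Z(d)]`** with the twist of the base-changed family written along its own structure map
`pr ≫ i ≫ pr₂ : Z' → 𝐏ⁿ_ℤ` (`𝒪_Z(d)` pulls back to `𝒪_{Z'}(d)`, ★ `isIso_pullbackTwistHom`, [Hartshorne1977] II Prop. 5.12 (c)).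
[cite: Hartshorne1977, III Thm. 12.11 (p. 290), Cor. 12.9] [cite: Hartshorne1977, II Prop. 5.12 (p. 117)] -/
theorem detClass_pushforward_twistMod_comp_eq_pullback
    (hP : IsFiniteLocallyFree ((Scheme.Modules.pushforward (i ≫ Morphisms.projectiveSpaceFst ι T)).obj
      (SerreTwist.twistMod (i ≫ pullback.snd (terminal.from T) (terminal.from (Morphisms.projectiveSpaceInt ι))) (unitModule Z) d)))
    (hP'' : IsFiniteLocallyFree ((Scheme.Modules.pushforward pT').obj
      (SerreTwist.twistMod (pr ≫ i ≫ pullback.snd (terminal.from T) (terminal.from (Morphisms.projectiveSpaceInt ι))) (unitModule ZT') d))) :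
    detClass hP'' = CechPic.pullback b (detClass hP) := by
  haveI := SerreTwist.isIso_pullbackTwistHom pr (i ≫ pullback.snd (terminal.from T) (terminal.from (Morphisms.projectiveSpaceInt ι))) d
  let e := (Scheme.Modules.pushforward pT').mapIso
    (asIso (SerreTwist.pullbackTwistHom pr (i ≫ pullback.snd (terminal.from T) (terminal.from (Morphisms.projectiveSpaceInt ι))) d))
  rw [← detClass_pushforward_pullback_twistMod_eq_pullback hn i P e₀ R hR hrk d k hk hd H hP (isFiniteLocallyFree_of_iso e.symm hP'')]
  exact (detClass_eq_of_iso e _ _).symm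

include hn hR hrk hk hd H in
/-- **The direct image of `𝒪_{Z'}(d)` on the base-changed family has rank `k = P(d)`** (★ ③b `hasRank_pushforward_twistMod_of_hasRank_twists`
on `Z`, transported along the base-change isomorphism and the pull-back of the twist). [cite: Mumford1966CurvesSurface, Lecture 15 (II.)]
[cite: Hartshorne1977, III Thm. 12.11 (p. 290), Cor. 12.9] -/
theorem hasRank_pushforward_twistMod_comp :
    HasRank ((Scheme.Modules.pushforward pT').obj
      (SerreTwist.twistMod (pr ≫ i ≫ pullback.snd (terminal.from T) (terminal.from (Morphisms.projectiveSpaceInt ι))) (unitModule ZT') d)) k := by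
  haveI := isIso_pushforwardBaseChangeHom_twistMod_of_hasRank_twists hn i P e₀ R hR hrk d k hk hd H
  haveI := SerreTwist.isIso_pullbackTwistHom pr (i ≫ pullback.snd (terminal.from T) (terminal.from (Morphisms.projectiveSpaceInt ι))) d
  exact hasRank_of_iso
    (asIso (pushforwardBaseChangeHom H.w
        (SerreTwist.twistMod (i ≫ pullback.snd (terminal.from T) (terminal.from (Morphisms.projectiveSpaceInt ι))) (unitModule Z) d)) ≪≫
      (Scheme.Modules.pushforward pT').mapIso
        (asIso (SerreTwist.pullbackTwistHom pr (i ≫ pullback.snd (terminal.from T) (terminal.from (Morphisms.projectiveSpaceInt ι))) d)))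
    (hasRank_pullback b (hasRank_pushforward_twistMod_of_hasRank_twists hn i P e₀ R hR hrk d k hk hd))

end Literature.AlgebraicGeometry.Motives

end
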